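import Summits.Ventures.PercRepro.C041RelaxedTriangleMain
import Summits.Ventures.PercRepro.C041BlockMapCoresPure

/-!
# THE RELAXED DOMAIN IS NOT AN INVARIANT OF `K₄`'s BLOCK MAP (p6, gen 38; P6-TWOEXIT-LEAN.md §50)

THEOREM (RELAXED TRIANGLE) and THEOREM (RELAXED DIAMONDS) say that (P) with the trivial bounds (`Rel`) propagates
through the triangle and through the two diamonds `K₄ − uu′`, `K₄ − au`.  It does NOT propagate through `K₄`: at the
relaxed-feasible inputs `sixF2 (2/5)` (a zone whose type-2 states are all invalid) and `sixF2m (2/5)` (its mirror)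
the output of `thetaK4` (`C041BlockMapCoresPure`, the block map of `K₄` in closed form) violates the Cauchy–Schwarz
condition: `(g − k)² / (t₁t₂) = 1.0428…`.  So any invariant that propagates through `K₄` must be strictly smaller
than `Rel` — e.g. `Rel` with the star inequality `(L₀ − M₁)² ≤ L₁ T₂` and its mirror (both valid on the cone, both
violated by every `sixF2 r`, `r > 0`).  The census of the two-exit cores on ≤ 5 vertices (own code, exact rationals):
20 of the 39 cores are `Rel`-adequate on every pair of generators, 19 are not, every failure at an `F2 × F2′` pair.
-/

namespace PercRepro

namespace RelaxedCores

open TreeClosure RelaxedTriangle ZoneZ.MultiExit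

/-- (P) FAILS at the output of `K₄` for the relaxed inputs `sixF2 (2/5)`, `sixF2m (2/5)`. -/
theorem not_K4v_thetaK4_F2_F2m : ¬ K4v (thetaK4 (sixF2 (2 / 5)) (sixF2m (2 / 5))) := by
  unfold K4v
  intro h
  have hcs := h.cs
  simp [thetaK4, sixF2, sixF2m, sixN, thB, thR, nAdm, kInv] at hcs
  norm_num at hcs

/-- **The relaxed domain is not an invariant of `K₄`**: there are relaxed-feasible zones `w, w′` with
`¬ K4v (thetaK4 w w′)` — the analogue of THEOREM (RELAXED TRIANGLE) for `K₄` is false. -/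
theorem not_relaxed_K4 : ¬ ∀ w w' : Vec6, Rel w → Rel w' → K4v (thetaK4 w w') := fun h =>
  not_K4v_thetaK4_F2_F2m (h _ _ (Rel_sixF2 _ (by norm_num)) (Rel_sixF2m _ (by norm_num)))

end RelaxedCores

end PercRepro
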